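import Summits.Parity.GeneralizedHardyLittlewood.Theorems.FordMaynardNoSieveConst0164NegWitness0164CellTrinomial
import Summits.Parity.GeneralizedHardyLittlewood.Theorems.FordMaynardNoSieveConst0164NegWitness0164TrinomialRanges

/-!
# Route `FordMaynardNoSieveConst0164`, crux `NegWitness0164` (stmt-Parity-19102), line `birth`,
# stub `stub_tweakNeg0164`: enclosure layer — a cell integral of (II') as an explicit polynomial (per range)

Helper file toward the certificate stub (K. Ford, J. Maynard, *On the theory of prime producing sieves*,
arXiv:2407.14368, §8).  Composition of `cell_integral_le_trinomial_0164` (`…CellTrinomial`) with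
`trinomial_box_integral_range_*_0164` (`…TrinomialRanges`): for a cell index `t : Fin 3 → Fin 24` and `α` with
`s = (α − Σ_k e_k)/w` in a given range, the cell integral `∫_{Δ₃(α)} 𝟙[cell t]/(v₀v₁v₂)` is (for the range versions, see NOTE) at most `w²` times an
EXPLICIT polynomial in `s` whose coefficients are explicit rational functions of the cell corners
`e_k = 41/250 + 7t_k/500` — no integral left; for a numeric `t` the right-hand side is a numeral polynomial in `α`
(`norm_num`).  This is the per-cell ingredient of the LINK step `Σ_τ lpCoeff0164(τ,j)·F_τ(α) ≤ P(α)` (census).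

* `cell_integral_le_zero_off_0164`, `cell_integral_le_zero_nonpos_0164` — the cell integral is `≤ 0` (hence `0`)
  when `s ≥ 3` or `s ≤ 0` (cells whose section misses `Δ₃(α)`).
NOTE: the three range versions with the polynomial WRITTEN OUT in terms of a symbolic `t` do not elaborate at default
heartbeats (25 KB statements); for a numeric `t` use `cell_integral_le_trinomial_0164 t α` and rewrite with
`trinomial_box_integral_range_*_0164` inside the proof (the instantiated goal is cheap), then `norm_num`.

Def-free (generated, scripts/gen_cellpoly.py).  References: [FordMaynard2024PrimeSieves] arXiv:2407.14368, §8.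
-/

noncomputable section

open Finset MeasureTheory Set
open scoped Classical
open Literature.NumberTheory.Sieve Literature.NumberTheory.Sieve.FordMaynard

namespace Summit.Parity.GeneralizedHardyLittlewood.FordMaynardNoSieveConst0164NegWitness0164

/-- **Cell integral vanishes (`≤ 0`) for `s ≥ 3`.** [folklore] -/
theorem cell_integral_le_zero_off_0164 (t : Fin 3 → Fin 24) (α : ℝ) (hs3 : 3 ≤ ((α - ∑ k : Fin 3, (41 / 250 + ((t k : Fin 24) : ℕ) * (7 / 500) : ℝ)) / (7 / 500))) :
    sliceIntegral 3 α (fun v : Fin 3 → ℝ => if ∀ k, (41 / 250 + (t k : ℕ) * (7 / 500) : ℝ) ≤ v k ∧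
        v k < 41 / 250 + ((t k : ℕ) + 1) * (7 / 500) then 1 / (v 0 * v 1 * v 2) else 0) ≤ 0 := by
  refine (cell_integral_le_trinomial_0164 t α).trans (le_of_eq ?_)
  rw [trinomial_box_integral_off_0164 _ _ _ _ _ _ _ _ _ hs3, mul_zero]

/-- **Cell integral vanishes (`≤ 0`) for `s ≤ 0`.** [folklore] -/
theorem cell_integral_le_zero_nonpos_0164 (t : Fin 3 → Fin 24) (α : ℝ) (hs : ((α - ∑ k : Fin 3, (41 / 250 + ((t k : Fin 24) : ℕ) * (7 / 500) : ℝ)) / (7 / 500)) ≤ 0) :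
    sliceIntegral 3 α (fun v : Fin 3 → ℝ => if ∀ k, (41 / 250 + (t k : ℕ) * (7 / 500) : ℝ) ≤ v k ∧
        v k < 41 / 250 + ((t k : ℕ) + 1) * (7 / 500) then 1 / (v 0 * v 1 * v 2) else 0) ≤ 0 := by
  refine (cell_integral_le_trinomial_0164 t α).trans (le_of_eq ?_)
  rw [trinomial_box_integral_nonpos_0164 _ _ _ _ _ _ _ _ _ hs, mul_zero]

end Summit.Parity.GeneralizedHardyLittlewood.FordMaynardNoSieveConst0164NegWitness0164

end
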